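import Summits.Ventures.YMGap.RobustBall.LocalPerturbationDecay
import Summits.Ventures.YMGap.RobustBall.UniformLoopCorrelatorDecay
import HarnessLib

/-!
# Venture YMGap, track ROBUST-BALL — LOCALITY for WILSON LOOPS: a modification of the action of ANY size at distance `D` from a loop
# moves its expectation by at most `8|γ|² 2^{−D}`

HONEST FRAMING. WHAT THIS IS: a venture file (cell `pub-ymgap`, track Y2 ROBUST-BALL, seat ds-3, theorems only): the Wilson-loop reading of
`LocalPerturbationDecay.lean` (Föllmer's Comparison Theorem (2.8) with defects). With rb-p1's loop observable `W_γ = Re tr U_γ/N`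
(`loopTerm N 1 γ`, Lipschitz constant `√N |γ|` on at most `|γ|` links, `isLipschitzCylinder_loopTerm`, `card_walkEdges_le_length`):
* ★ `su2_wilson_loop_localPerturbation_upTo_oneTwelfth` — `SU(2)` on `ℤ⁴`, `0 ≤ β_W ≤ 1/12` (tree coupling `β_W/2`): for ANY DLR state `μ` of
  the Wilson action, ANY continuous finite-range perturbation `(W', supp')` (terms reading their own links, locally finite, NO smallness) with no
  term through a link of `Λ`, ANY DLR state `ν` of the perturbed action, and every closed walk `γ` whose links are at depth `≥ D` in `Λ`:
  `|⟨W_γ⟩_ν − ⟨W_γ⟩_μ| ≤ 8 · |γ|² · (1/2)^{⌊D⌋}`;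
* ★ `su2_loop_localDLR_of_memBallZd` — on the tier-1 ball (`SU(2)`, every `d`, sharp pair): for ANY probability measure `ν` with the member's
  single-link DLR equations on `Λ`: `|⟨c W_γ⟩_ν − ⟨c W_γ⟩_μ| ≤ (4|c|/(1 − ρ′)) · |γ|² · ρ′^{⌊D/max(1,R)⌋}`, `ρ′ = max(ρ,½)`.
WHAT THIS IS NOT: lattice strong coupling; nothing about the continuum limit or the Clay Millennium problem.

References: H. Föllmer, LNM 1362 (1988), Ch. I, (2.8); the seat's `LocalPerturbationDecay.lean`, `WilsonLoopBoundaryDecay.lean`; rb-p1's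
`UniformLoopCorrelatorDecay.lean`.
-/

noncomputable section

open MeasureTheory Filter Function ProbabilityTheory Real SimpleGraph
open scoped NNReal
open Literature.Probability.LatticeModels
open Literature.MathematicalPhysics.QuantumLattice
open Literature.MathematicalPhysics.QuantumFieldTheory hiding ZdEdge Site
open Literature.MathematicalPhysics.QuantumFieldTheory (walkEdges card_walkEdges_le_length)

namespace Summit.Ventures.YMGap.RobustBall

variable {d N : ℕ}

/-- Bookkeeping: `A · (|c| √N |γ|) · #(links of γ) · r ≤ A √N |c| · |γ|² · r` for `A, r ≥ 0`. [folklore] -/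
theorem loop_constant_le' (c : ℝ) {x : Literature.Probability.LatticeModels.Site d} (w : (zdGraph d).Walk x x) {A r : ℝ} (hA : 0 ≤ A)
    (hr : 0 ≤ r) :
    A * ((⟨|c| * Real.sqrt N * w.length, by positivity⟩ : ℝ≥0) : ℝ) * (walkEdges w).card * r ≤
      A * Real.sqrt N * |c| * (w.length : ℝ) ^ 2 * r := by
  show A * (|c| * Real.sqrt N * w.length) * (walkEdges w).card * r ≤ _
  have hcard : ((walkEdges w).card : ℝ) ≤ w.length := by exact_mod_cast card_walkEdges_le_length w
  have h0 : 0 ≤ A * (|c| * Real.sqrt N * w.length) * r := by positivity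
  calc A * (|c| * Real.sqrt N * w.length) * (walkEdges w).card * r
      = (A * (|c| * Real.sqrt N * w.length) * r) * (walkEdges w).card := by ring
    _ ≤ (A * (|c| * Real.sqrt N * w.length) * r) * w.length := mul_le_mul_of_nonneg_left hcard h0
    _ = A * Real.sqrt N * |c| * (w.length : ℝ) ^ 2 * r := by ring

/-- ★ **`SU(2)` on `ℤ⁴`, `0 ≤ β_W ≤ 1/12`: A LOCAL PERTURBATION OF ANY SIZE AT DISTANCE `D` FROM A WILSON LOOP MOVES ITS EXPECTATION BY AT MOST
`8|γ|² 2^{−D}`.** For ANY DLR state `μ` of the Wilson action (tree coupling `β_W/2`), ANY continuous finite-range perturbation `(W', supp')` with no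
term through a link of `Λ` (`hamiltonianIn W' supp' {x} = 0`, `x ∈ Λ`), ANY DLR state `ν` of `(β_W/2) S_W + W'`, and every closed walk `γ` whose
links are at base-point depth `≥ D` in `Λ`: `|∫ W_γ dν − ∫ W_γ dμ| ≤ 8 · |γ|² · (1/2)^{⌊D⌋}`. [folklore] -/
theorem su2_wilson_loop_localPerturbation_upTo_oneTwelfth {βW : ℝ} (h0 : 0 ≤ βW) (h : βW ≤ 1 / 12)
    {μ : Measure (LGConfig 4 (SUN 2))} (hμ : μ ∈ ymGibbsMeasures (d := 4) (fundamentalRep (Fin 2)) (βW / 2))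
    {W' : Potential (ZdEdge 4) (SUN 2)} (hW'c : ∀ X, Continuous (W' X)) (hW'dep : ∀ X, DependsOn (W' X) (↑X : Set (ZdEdge 4)))
    {supp' : Finset (ZdEdge 4) → Finset (Finset (ZdEdge 4))} (hsupp' : W'.IsSupportedBy supp')
    {ν : Measure (LGConfig 4 (SUN 2))} (hν : ν ∈ perturbedGibbsMeasures (d := 4) (fundamentalRep (Fin 2)) (βW / 2) W' supp')
    (Λ : Finset (ZdEdge 4)) (hfree : ∀ x ∈ Λ, hamiltonianIn W' supp' {x} = 0)
    {x : Literature.Probability.LatticeModels.Site 4} (w : (zdGraph 4).Walk x x) {D : ℝ}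
    (hD : ∀ y ∈ walkEdges w, ∀ z, z ∉ Λ → D ≤ ‖y.1 - z.1‖) :
    |(∫ U, loopTerm 2 1 w U ∂ν) - ∫ U, loopTerm 2 1 w U ∂μ| ≤ 8 * (w.length : ℝ) ^ 2 * (1 / 2 : ℝ) ^ ⌊D⌋₊ := by
  have h1 := su2_wilson_localPerturbation_upTo_oneTwelfth h0 h hμ hW'c hW'dep hsupp' hν Λ hfree (isLipschitzCylinder_loopTerm (N := 2) 1 w) hD
  have hr : 0 ≤ (1 / 2 : ℝ) ^ ⌊D⌋₊ := pow_nonneg (by norm_num) _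
  refine (h1.trans (loop_constant_le' (N := 2) 1 w (by positivity) hr)).trans (le_of_eq ?_)
  have hsq : Real.sqrt 2 * Real.sqrt ((2 : ℕ) : ℝ) = 2 := by
    rw [show ((2 : ℕ) : ℝ) = 2 by norm_num]; exact Real.mul_self_sqrt (by norm_num)
  rw [abs_one]
  calc 4 * Real.sqrt 2 * Real.sqrt ((2 : ℕ) : ℝ) * 1 * (w.length : ℝ) ^ 2 * (1 / 2 : ℝ) ^ ⌊D⌋₊
      = 4 * (Real.sqrt 2 * Real.sqrt ((2 : ℕ) : ℝ)) * (w.length : ℝ) ^ 2 * (1 / 2 : ℝ) ^ ⌊D⌋₊ := by ring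
    _ = 8 * (w.length : ℝ) ^ 2 * (1 / 2 : ℝ) ^ ⌊D⌋₊ := by rw [hsq]; ring

/-- ★ **WILSON LOOPS vs ANY LOCALLY-DLR MEASURE, `SU(2)`, every `d ≥ 1`, on the tier-1 ball** (sharp pair; Wilson units, 't Hooft `β_W/4`): if
`2(d−1)|β_W| e^{ε₀} + e^{ε₀/2} √(2/3) ε₁ ≤ ρ < 1` then for every member `(W, supp)` of `MemBallZd ε₀ ε₁ R`, every DLR state `μ`, every probability
measure `ν` with the member's single-link DLR equations on `Λ`, every coupling `c` and every closed walk `γ` at depth `≥ D` in `Λ`: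
`|∫ c W_γ dν − ∫ c W_γ dμ| ≤ (4|c|/(1 − ρ′)) · |γ|² · ρ′^{⌊D / max(1,R)⌋}`, `ρ′ = max(ρ,½)`. [folklore] -/
theorem su2_loop_localDLR_of_memBallZd (hd : 1 ≤ d) {βW ε₀ ε₁ ρ R : ℝ}
    (hρ : 2 * ((d : ℝ) - 1) * |βW| * exp ε₀ + exp (ε₀ / 2) * Real.sqrt (2 / 3) * ε₁ ≤ ρ) (hρ1 : ρ < 1)
    {W : Potential (ZdEdge d) (SUN 2)} {supp : Finset (ZdEdge d) → Finset (Finset (ZdEdge d))} (hmem : MemBallZd ε₀ ε₁ R W supp)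
    {μ : Measure (LGConfig d (SUN 2))} (hμ : μ ∈ perturbedGibbsMeasures (d := d) (fundamentalRep (Fin 2)) ((2 : ℕ) * (βW / 4)) W supp)
    (ν : Measure (LGConfig d (SUN 2))) [IsProbabilityMeasure ν] (Λ : Finset (ZdEdge d))
    (hν : ∀ x ∈ Λ, ν.bind (perturbedYM (d := d) (fundamentalRep (Fin 2)) ((2 : ℕ) * (βW / 4)) W supp {x}) = ν) (c : ℝ)
    {x : Literature.Probability.LatticeModels.Site d} (w : (zdGraph d).Walk x x) {D : ℝ}
    (hD : ∀ y ∈ walkEdges w, ∀ z, z ∉ Λ → D ≤ ‖y.1 - z.1‖) :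
    |(∫ U, loopTerm 2 c w U ∂ν) - ∫ U, loopTerm 2 c w U ∂μ| ≤
      4 * |c| / (1 - max ρ (1 / 2)) * (w.length : ℝ) ^ 2 * (max ρ (1 / 2)) ^ ⌊D / max 1 R⌋₊ := by
  have h1 := su2_abs_integral_sub_integral_le_of_localDLR hd hρ hρ1 hmem hμ ν Λ hν (isLipschitzCylinder_loopTerm (N := 2) c w) hD
  have hc'1 : max ρ (1 / 2) < 1 := max_lt hρ1 (by norm_num)
  have h1ρ : 0 < 1 - max ρ (1 / 2) := by linarith
  have hr : 0 ≤ (max ρ (1 / 2)) ^ ⌊D / max 1 R⌋₊ := pow_nonneg (le_max_of_le_right (by norm_num)) _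
  have hA : 0 ≤ 2 * Real.sqrt 2 / (1 - max ρ (1 / 2)) := div_nonneg (by positivity) h1ρ.le
  refine (h1.trans (loop_constant_le' (N := 2) c w hA hr)).trans (le_of_eq ?_)
  have hsq : Real.sqrt 2 * Real.sqrt ((2 : ℕ) : ℝ) = 2 := by
    rw [show ((2 : ℕ) : ℝ) = 2 by norm_num]; exact Real.mul_self_sqrt (by norm_num)
  have hne : 1 - max ρ (1 / 2) ≠ 0 := h1ρ.ne'
  calc 2 * Real.sqrt 2 / (1 - max ρ (1 / 2)) * Real.sqrt ((2 : ℕ) : ℝ) * |c| * (w.length : ℝ) ^ 2 * (max ρ (1 / 2)) ^ ⌊D / max 1 R⌋₊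
      = 2 * (Real.sqrt 2 * Real.sqrt ((2 : ℕ) : ℝ)) / (1 - max ρ (1 / 2)) * |c| * (w.length : ℝ) ^ 2 * (max ρ (1 / 2)) ^ ⌊D / max 1 R⌋₊ := by
        ring
    _ = 4 * |c| / (1 - max ρ (1 / 2)) * (w.length : ℝ) ^ 2 * (max ρ (1 / 2)) ^ ⌊D / max 1 R⌋₊ := by rw [hsq]; ring

end Summit.Ventures.YMGap.RobustBall

end
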